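import Summits.QuantumAdvantage.QuantumAdvantage.Theorems.CubicForrelationNearExactIsExactFourteenSecondBent
import Summits.QuantumAdvantage.QuantumAdvantage.Theorems.CubicForrelationNearExactIsExactZeroModSixSecondLevelTwo

/-!
# Crux `CubicForrelation.NearExactIsExact` (stmt-QuantumAdvantage-14043) — `n = 6r+2`, TWO-SIDED: the level `2r+4` configuration
  (`W_g ∈ 2^{2r+4}ℤ` with an odd quotient) never reaches the second boundary `Φ = 1 − 2^{−2r}` (`r ≥ 4`)

Certificate seat `b2b-cforr-cert` (gen 9).  HONEST FRAMING: a theorem uniform in `r` about cubic Boolean pairs on `6r+2` bits (the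
codimension-5 level configuration at the SECOND dyadic boundary on `n ≡ 2 (mod 6)`, `n ≥ 26`); NOT summit progress.  New relative to the
codimension-3 twin `tm2_levelThree_false`: the parity `p = [u''' odd]` (`W_g = 2^{2r+4}u'''`) has degree `≤ 5` (tower), the budget
`Σ(u − 2^r s)² = 64Σ(u''' − 2^{r−3}s)² ≤ 2^{6r+3}` pays `≥ 64` per odd point and `RM(5, 6r+2)` gives `#P ≥ 2^{6r−3}`: `P` is a `(6r−3)`-FLAT of
codimension FIVE, so the localisation needs FIVE transversal directions (the doubling construction `fo_double_closed` / `fo_mem_flatPt` /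
`fr_sum_peel` of the 14-bit bent file) and the general 8- and 9-flat sums (`32 ∣ Σ₈ u`, `64 ∣ Σ₉ u`, Ax for `f`) give (H3)/(H4) along `P`;
`fl1_flat_l1` bounds `(Σ|(e1_P)^|)² ≤ 2^{12r+6}` while the pairing needs `Σ_y (−1)^g (e1_P)^(y) = 2^{8r}`: `tm2_levelFour_false`.  (At
`r = 3`, `n = 20`, level `10` is the top level and `2^{r−3}s` is odd — a separate bent-forcing case.)

References: J. Ax (1964) / R. J. McEliece (1972); MacWilliams–Sloane (1977) Ch. 13–15; R. O'Donnell (2014) §3.3.  Everything below is proved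
from Mathlib and the tree; axioms are the standard three.
-/

set_option linter.dupNamespace false -- D-0017: single-problem summit ⇒ `QuantumAdvantage.QuantumAdvantage` by design

noncomputable section

namespace Summit.QuantumAdvantage.QuantumAdvantage.Theorems.CubicForrelation.NearExactIsExact

open Finset
open Literature.Computability.QuantumComplexity
open Literature.Computability.QuantumComplexity.BuzetChailloux (bxor zeroVec bxor_bxor_cancel_left bxor_zeroVec zeroVec_bxor bxor_comm
  bxor_self)
open Literature.Computability.QuantumComplexity.DerivativeWalsh (W)

/-- **Level `2r+4` with an odd quotient never reaches `Φ = 1 − 2^{−2r}` on `6r+2` bits (`r ≥ 4`).**  For cubic `f, g` with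
`W_g = 2^{2r+4}·u'''`, some `u'''(x)` odd, and `Φ(f,g) ≥ 1 − (1/2)^{2r}`: contradiction.  Uniform in `r`; NOT summit progress. [this work] -/
theorem tm2_levelFour_false (r : ℕ) (hr : 4 ≤ r) (f g : (Fin ((3 * r + 1) + (3 * r + 1)) → Bool) → Bool) (hf : IsDegLeFun 3 f)
    (hg : IsDegLeFun 3 g) (u'' : (Fin ((3 * r + 1) + (3 * r + 1)) → Bool) → ℤ)
    (hu'' : ∀ x, W (fun y => signOf (g y)) x = (2 : ℝ) ^ (2 * r + 4) * (u'' x : ℝ)) (hodd : ∃ x, Odd (u'' x))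
    (hΦ : 1 - (1 / 2 : ℝ) ^ (2 * r) ≤ forrelation f g) : False := by
  classical
  obtain ⟨x₁, hx₁⟩ := hodd
  obtain ⟨k, rfl⟩ : ∃ k, r = k + 4 := ⟨r - 4, by omega⟩
  -- `u = 8u''` at the Ax level
  set u : (Fin ((3 * (k + 4) + 1) + (3 * (k + 4) + 1)) → Bool) → ℤ := fun x => 8 * u'' x with hudef
  have hu : ∀ x, W (fun y => signOf (g y)) x = (2 : ℝ) ^ (2 * (k + 4) + 1) * (u x : ℝ) := by
    intro x; rw [hu'' x]; simp only [u]; push_cast; ring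
  -- the parity of `u''` has degree `≤ 5`
  have hp : IsDegLeFun 5 (fun x => decide (Odd (u'' x))) :=
    stub_walshTower stub_axParity ((3 * (k + 4) + 1) + (3 * (k + 4) + 1)) (2 * (k + 4) + 4) 5 g u'' hg hu''
      (by intro j hj hjn; omega)
  have hp' : IsDegLeFun (4 + 1) (fun x => decide (Odd (u'' x))) := hp
  -- budget
  have hbud := tms_budget (k + 4) f g u hu
  have hpow : (2 : ℝ) ^ (8 * (k + 4) + 3) * (1 / 2) ^ (2 * (k + 4)) = 2 ^ (6 * k + 27) := by
    rw [one_div_pow]; field_simp; ring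
  have hB0 : (∑ x, (u x - 2 ^ (k + 4) * sZ (f x)) ^ 2 : ℤ) ≤ 2 ^ (6 * k + 27) := by
    have h1 : 1 - forrelation f g ≤ (1 / 2 : ℝ) ^ (2 * (k + 4)) := by linarith
    have h' : ((∑ x, (u x - 2 ^ (k + 4) * sZ (f x)) ^ 2 : ℤ) : ℝ) ≤ (2 : ℝ) ^ (6 * k + 27) := by
      rw [hbud, ← hpow]
      exact mul_le_mul_of_nonneg_left h1 (by positivity)
    exact_mod_cast h'
  have hpow8 : (2 : ℤ) ^ (k + 4) = 8 * 2 ^ (k + 1) := by ring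
  have h64 : ∀ x, (u x - 2 ^ (k + 4) * sZ (f x)) ^ 2 = 64 * (u'' x - 2 ^ (k + 1) * sZ (f x)) ^ 2 := fun x => by
    simp only [u]; rw [hpow8]; ring
  have hB : (∑ x, (u'' x - 2 ^ (k + 1) * sZ (f x)) ^ 2 : ℤ) ≤ 2 ^ (6 * k + 21) := by
    have h'' := hB0
    rw [sum_congr rfl fun x _ => h64 x, ← mul_sum, show (2 : ℤ) ^ (6 * k + 27) = 64 * 2 ^ (6 * k + 21) by ring] at h''
    linarith
  -- RM: `#P ≥ 2^{6r−3}`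
  set P := univ.filter (fun x : Fin ((3 * (k + 4) + 1) + (3 * (k + 4) + 1)) → Bool => Odd (u'' x)) with hPdef
  have hmemP : ∀ x, x ∈ P ↔ Odd (u'' x) := fun x => by simp [hPdef]
  have hfilt : (univ.filter fun x : Fin ((3 * (k + 4) + 1) + (3 * (k + 4) + 1)) → Bool => decide (Odd (u'' x)) = true) = P :=
    filter_congr fun x _ => by simp
  have hRM := bb_rmWeight_holds ((3 * (k + 4) + 1) + (3 * (k + 4) + 1)) 5 (fun x => decide (Odd (u'' x))) hp ⟨x₁, by simpa using hx₁⟩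
  rw [hfilt] at hRM
  have hPge : 2 ^ (6 * k + 21) ≤ #P := by
    have h2 : (2 : ℕ) ^ ((3 * (k + 4) + 1) + (3 * (k + 4) + 1)) = 2 ^ 5 * 2 ^ (6 * k + 21) := by ring
    rw [h2] at hRM
    exact Nat.le_of_mul_le_mul_left hRM (by positivity)
  -- everything is tight
  have hsumP : (∑ x, (if Odd (u'' x) then 1 else 0 : ℤ)) = #P := by rw [sum_boole]
  have hnonneg : ∀ x, 0 ≤ (u'' x - 2 ^ (k + 1) * sZ (f x)) ^ 2 - (if Odd (u'' x) then 1 else 0 : ℤ) := by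
    intro x
    by_cases h : Odd (u'' x)
    · rw [if_pos h]
      have hodd' : Odd (u'' x - 2 ^ (k + 1) * sZ (f x)) := by
        have h2 : Even ((2 : ℤ) ^ (k + 1) * sZ (f x)) := by rw [pow_succ]; exact ⟨2 ^ k * sZ (f x), by ring⟩
        exact Int.odd_sub.2 (iff_of_true h h2)
      have h0 := Int.odd_iff.1 hodd'
      have : u'' x - 2 ^ (k + 1) * sZ (f x) ≤ -1 ∨ 1 ≤ u'' x - 2 ^ (k + 1) * sZ (f x) := by omega
      have := tp_sq_ge (k := 1) (by norm_num) this
      linarith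
    · rw [if_neg h]; have := sq_nonneg (u'' x - 2 ^ (k + 1) * sZ (f x)); linarith
  have hPge' : (2 : ℤ) ^ (6 * k + 21) ≤ #P := by exact_mod_cast hPge
  have hsum0 : ∑ x, ((u'' x - 2 ^ (k + 1) * sZ (f x)) ^ 2 - (if Odd (u'' x) then 1 else 0 : ℤ)) = 0 := by
    refine le_antisymm ?_ (sum_nonneg fun x _ => hnonneg x)
    rw [sum_sub_distrib, hsumP]
    linarith
  have hzero' : ∀ x, (u'' x - 2 ^ (k + 1) * sZ (f x)) ^ 2 - (if Odd (u'' x) then 1 else 0 : ℤ) = 0 :=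
    fun x => (sum_eq_zero_iff_of_nonneg fun y _ => hnonneg y).1 hsum0 x (mem_univ x)
  have hoff : ∀ x, ¬ Odd (u'' x) → u'' x - 2 ^ (k + 1) * sZ (f x) = 0 := by
    intro x hx
    have h := hzero' x
    rw [if_neg hx, sub_zero] at h
    exact (pow_eq_zero_iff two_ne_zero).1 h
  have hon : ∀ x, Odd (u'' x) → u'' x - 2 ^ (k + 1) * sZ (f x) = 1 ∨ u'' x - 2 ^ (k + 1) * sZ (f x) = -1 := by
    intro x hx
    have h := hzero' x
    rw [if_pos hx] at h
    have h1 : (u'' x - 2 ^ (k + 1) * sZ (f x)) * (u'' x - 2 ^ (k + 1) * sZ (f x)) = 1 := by rw [← pow_two]; linarith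
    exact mul_self_eq_one_iff.1 h1
  have hPcard : #P = 2 ^ (6 * k + 21) := by
    have hle : (#P : ℤ) ≤ 2 ^ (6 * k + 21) := by
      rw [← hsumP]
      exact le_trans (sum_le_sum fun x _ => by have := hnonneg x; linarith) hB
    have hle' : #P ≤ 2 ^ (6 * k + 21) := by exact_mod_cast hle
    exact le_antisymm hle' hPge
  have hTeq : (2 : ℝ) ^ (8 * (k + 4) + 3) * (1 - forrelation f g) = 2 ^ (6 * k + 27) := by
    have hT : (∑ x, (u x - 2 ^ (k + 4) * sZ (f x)) ^ 2 : ℤ) = 2 ^ (6 * k + 27) := by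
      have e64 : ∀ x, (u x - 2 ^ (k + 4) * sZ (f x)) ^ 2 = 64 * ((u'' x - 2 ^ (k + 1) * sZ (f x)) ^ 2 -
          (if Odd (u'' x) then 1 else 0 : ℤ)) + 64 * (if Odd (u'' x) then 1 else 0 : ℤ) := fun x => by rw [h64 x]; ring
      rw [sum_congr rfl fun x _ => e64 x, sum_add_distrib, ← mul_sum, ← mul_sum, hsum0, hsumP, hPcard]
      push_cast; ring
    have h : ((∑ x, (u x - 2 ^ (k + 4) * sZ (f x)) ^ 2 : ℤ) : ℝ) = 2 ^ (6 * k + 27) := by exact_mod_cast hT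
    rw [hbud] at h
    exact h
  -- `P` is a `(6r−3)`-flat
  have hmw := mw_flat_of_minweight 4 (fun x => decide (Odd (u'' x))) hp' (by rw [hfilt, hPcard]; ring)
  rw [hfilt] at hmw
  obtain ⟨h0, hadd, hcardV, hcoset⟩ := hmw
  set V₀ := univ.filter (fun a : Fin ((3 * (k + 4) + 1) + (3 * (k + 4) + 1)) → Bool => ∀ x,
    decide (Odd (u'' (bxor x a))) = decide (Odd (u'' x))) with hV₀
  have hS : P = V₀.image (bxor x₁) := hcoset x₁ (by simpa using hx₁)
  rw [hPcard] at hcardV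
  have hNcard : #(univ : Finset (Fin ((3 * (k + 4) + 1) + (3 * (k + 4) + 1)) → Bool)) = 2 ^ (6 * k + 26) := by
    rw [card_univ, Fintype.card_fun, Fintype.card_bool, Fintype.card_fin]; ring
  -- the sign pattern and the vanishing of the residual off `P`
  set e : (Fin ((3 * (k + 4) + 1) + (3 * (k + 4) + 1)) → Bool) → ℤ := fun x => u'' x - 2 ^ (k + 1) * sZ (f x) with hedef
  have he : ∀ x ∈ P, e x = 1 ∨ e x = -1 := fun x hx => hon x ((hmemP x).1 hx)
  set F : (Fin ((3 * (k + 4) + 1) + (3 * (k + 4) + 1)) → Bool) → ℤ := fun y => u y - 2 ^ (k + 4) * sZ (f y) with hFdef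
  have hF0 : ∀ y, y ∉ P → F y = 0 := by
    intro y hy
    have := hoff y (fun h => hy ((hmemP y).2 h))
    simp only [F, u]; rw [hpow8]; linarith
  have hFe : ∀ y, F y = 8 * e y := fun y => by simp only [F, u, e]; rw [hpow8]; ring
  have hPV : ∀ x, x ∈ P → ∀ a ∈ V₀, bxor x a ∈ P := fun x hx a ha => fl1_coset_vadd hadd hS hx ha
  -- peeling one transversal direction
  have hpeel : ∀ (U : Finset (Fin ((3 * (k + 4) + 1) + (3 * (k + 4) + 1)) → Bool)), zeroVec ∈ U →
      (∀ a ∈ U, ∀ b ∈ U, bxor a b ∈ U) → V₀ ⊆ U → ∀ t, t ∉ U → ∀ q, q ∈ P →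
      ∀ {kk : ℕ} (a : Fin kk → Fin ((3 * (k + 4) + 1) + (3 * (k + 4) + 1)) → Bool), (∀ i, a i ∈ U) →
      ∑ ε : Fin (kk + 1) → Bool, F (fun j => q j ^^ decide (Odd #(univ.filter fun i =>
          ε i && (Matrix.vecCons t a : Fin (kk + 1) → Fin ((3 * (k + 4) + 1) + (3 * (k + 4) + 1)) → Bool) i j))) =
        ∑ ε : Fin kk → Bool, F (fun j => q j ^^ decide (Odd #(univ.filter fun i => ε i && a i j))) := by
    intro U hU0 hUadd hVU t ht q hq kk a ha
    rw [fr_sum_peel F q t a]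
    have hz : ∑ ε : Fin kk → Bool, F (bxor (fun j => q j ^^ decide (Odd #(univ.filter fun i => ε i && a i j))) t) = 0 := by
      refine sum_eq_zero fun ε _ => hF0 _ fun hmem => ?_
      set S := U.image (bxor q) with hSU
      have hpt : (fun j => q j ^^ decide (Odd #(univ.filter fun i => ε i && a i j))) ∈ S :=
        fo_mem_flatPt U hU0 (· ∈ S) (fun x hx b hb => fl1_coset_vadd hUadd hSU hx hb)
          (show q ∈ S from mem_image.2 ⟨zeroVec, hU0, bxor_zeroVec q⟩) a ha ε
      apply fl1_coset_out hU0 hUadd hSU hpt ht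
      have hq' : q ∈ V₀.image (bxor x₁) := hS ▸ hq
      have hmem' : bxor (fun j => q j ^^ decide (Odd #(univ.filter fun i => ε i && a i j))) t ∈ V₀.image (bxor x₁) := hS ▸ hmem
      obtain ⟨v, hv, hvx⟩ := mem_image.1 hmem'
      obtain ⟨v₀, hv₀, hv₀q⟩ := mem_image.1 hq'
      refine mem_image.2 ⟨bxor v₀ v, hVU (hadd v₀ hv₀ v hv), ?_⟩
      rw [← hvx, ← hv₀q, iw_bxor_assoc, bxor_bxor_cancel_left]
    rw [hz, add_zero]
  -- five transversal directions by doubling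
  have hpick : ∀ (U : Finset (Fin ((3 * (k + 4) + 1) + (3 * (k + 4) + 1)) → Bool)), #U < 2 ^ (6 * k + 26) → ∃ t, t ∉ U :=
    fun U hU => by
      obtain ⟨t, -, ht⟩ := exists_mem_notMem_of_card_lt_card (hNcard ▸ hU); exact ⟨t, ht⟩
  have hX : (0 : ℕ) < 2 ^ (6 * k + 21) := Nat.two_pow_pos _
  have hN : (2 : ℕ) ^ (6 * k + 26) = 32 * 2 ^ (6 * k + 21) := by ring
  obtain ⟨t₅, ht₅⟩ := hpick V₀ (by rw [hcardV, hN]; omega)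
  obtain ⟨h40, h4add, h4sub, h4t, h4card⟩ := fo_double_closed V₀ h0 hadd t₅
  set U₄ := V₀ ∪ V₀.image (bxor t₅) with hU₄
  obtain ⟨t₄, ht₄⟩ := hpick U₄ (by rw [hcardV] at h4card; rw [hN]; omega)
  obtain ⟨h30, h3add, h3sub, h3t, h3card⟩ := fo_double_closed U₄ h40 h4add t₄
  set U₃ := U₄ ∪ U₄.image (bxor t₄) with hU₃
  obtain ⟨t₃, ht₃⟩ := hpick U₃ (by rw [hcardV] at h4card; rw [hN]; omega)
  obtain ⟨h20, h2add, h2sub, h2t, h2card⟩ := fo_double_closed U₃ h30 h3add t₃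
  set U₂ := U₃ ∪ U₃.image (bxor t₃) with hU₂
  obtain ⟨t₂, ht₂⟩ := hpick U₂ (by rw [hcardV] at h4card; rw [hN]; omega)
  obtain ⟨h10, h1add, h1sub, h1t, h1card⟩ := fo_double_closed U₂ h20 h2add t₂
  set U₁ := U₂ ∪ U₂.image (bxor t₂) with hU₁
  obtain ⟨t₁, ht₁⟩ := hpick U₁ (by rw [hcardV] at h4card; rw [hN]; omega)
  -- localisation of a `(kk+5)`-flat sum to the `kk`-flat inside `P`
  have hloc : ∀ q, q ∈ P → ∀ {kk : ℕ} (a : Fin kk → Fin ((3 * (k + 4) + 1) + (3 * (k + 4) + 1)) → Bool), (∀ i, a i ∈ V₀) →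
      ∑ ε : Fin (kk + 1 + 1 + 1 + 1 + 1) → Bool, F (fun j => q j ^^ decide (Odd #(univ.filter fun i =>
          ε i && (Matrix.vecCons t₁ (Matrix.vecCons t₂ (Matrix.vecCons t₃ (Matrix.vecCons t₄ (Matrix.vecCons t₅ a)))) :
            Fin (kk + 1 + 1 + 1 + 1 + 1) → Fin ((3 * (k + 4) + 1) + (3 * (k + 4) + 1)) → Bool) i j))) =
        ∑ ε : Fin kk → Bool, 8 * e (fun j => q j ^^ decide (Odd #(univ.filter fun i => ε i && a i j))) := by
    intro q hq kk a ha
    have m5 : ∀ i, (Matrix.vecCons t₅ a : Fin (kk + 1) → _) i ∈ U₄ := by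
      intro i; refine Fin.cases ?_ (fun i => ?_) i
      · exact h4t
      · simp only [Matrix.cons_val_succ]; exact h4sub (ha i)
    have m4 : ∀ i, (Matrix.vecCons t₄ (Matrix.vecCons t₅ a) : Fin (kk + 1 + 1) → _) i ∈ U₃ := by
      intro i; refine Fin.cases ?_ (fun i => ?_) i
      · exact h3t
      · simp only [Matrix.cons_val_succ]; exact h3sub (m5 i)
    have m3 : ∀ i, (Matrix.vecCons t₃ (Matrix.vecCons t₄ (Matrix.vecCons t₅ a)) : Fin (kk + 1 + 1 + 1) → _) i ∈ U₂ := by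
      intro i; refine Fin.cases ?_ (fun i => ?_) i
      · exact h2t
      · simp only [Matrix.cons_val_succ]; exact h2sub (m4 i)
    have m2 : ∀ i, (Matrix.vecCons t₂ (Matrix.vecCons t₃ (Matrix.vecCons t₄ (Matrix.vecCons t₅ a))) :
        Fin (kk + 1 + 1 + 1 + 1) → _) i ∈ U₁ := by
      intro i; refine Fin.cases ?_ (fun i => ?_) i
      · exact h1t
      · simp only [Matrix.cons_val_succ]; exact h1sub (m3 i)
    rw [hpeel U₁ h10 h1add (h4sub.trans (h3sub.trans (h2sub.trans h1sub))) t₁ ht₁ q hq _ m2,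
      hpeel U₂ h20 h2add (h4sub.trans (h3sub.trans h2sub)) t₂ ht₂ q hq _ m3,
      hpeel U₃ h30 h3add (h4sub.trans h3sub) t₃ ht₃ q hq _ m4,
      hpeel U₄ h40 h4add h4sub t₄ ht₄ q hq _ m5,
      hpeel V₀ h0 hadd subset_rfl t₅ ht₅ q hq a ha]
    exact sum_congr rfl fun ε _ => hFe _
  -- (H3) and (H4)
  have H3 : ∀ x ∈ P, ∀ a b c : Fin ((3 * (k + 4) + 1) + (3 * (k + 4) + 1)) → Bool, a ∈ V₀ → b ∈ V₀ → c ∈ V₀ →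
      (4 : ℤ) ∣ ∑ ε : Fin 3 → Bool, e (fun j => x j ^^ decide (Odd #(univ.filter fun i =>
        ε i && (![a, b, c] : Fin 3 → Fin ((3 * (k + 4) + 1) + (3 * (k + 4) + 1)) → Bool) i j))) := by
    intro x hx a b c ha hb hc
    have hdv := fs_flat_sum_dvd (e := 5) g u hg hu x ![t₁, t₂, t₃, t₄, t₅, a, b, c] (by omega)
    obtain ⟨zf, hzf⟩ := sl_sum_sZ_flat f hf x ![t₁, t₂, t₃, t₄, t₅, a, b, c]
    have hzf' : ∑ ε : Fin 8 → Bool, 2 ^ (k + 4) * sZ (f (fun j => x j ^^ decide (Odd #(univ.filter fun i =>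
          ε i && (![t₁, t₂, t₃, t₄, t₅, a, b, c] : Fin 8 → Fin ((3 * (k + 4) + 1) + (3 * (k + 4) + 1)) → Bool) i j)))) =
        2 ^ 5 * (2 ^ (k + 2) * zf) := by
      rw [← mul_sum, hzf]; norm_num; ring
    have h32 : (2 : ℤ) ^ 5 ∣ ∑ ε : Fin 8 → Bool, F (fun j => x j ^^ decide (Odd #(univ.filter fun i =>
          ε i && (![t₁, t₂, t₃, t₄, t₅, a, b, c] : Fin 8 → Fin ((3 * (k + 4) + 1) + (3 * (k + 4) + 1)) → Bool) i j))) := by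
      simp only [F]
      rw [sum_sub_distrib, hzf']
      exact dvd_sub hdv (Dvd.intro _ rfl)
    rw [hloc x hx ![a, b, c] (fun i => by fin_cases i <;> assumption), ← mul_sum,
      show (2 : ℤ) ^ 5 = 8 * 4 by norm_num] at h32
    exact (mul_dvd_mul_iff_left (by norm_num : (8 : ℤ) ≠ 0)).1 h32
  have H4 : ∀ x ∈ P, ∀ a₀ a₁ a₂ a₃ : Fin ((3 * (k + 4) + 1) + (3 * (k + 4) + 1)) → Bool, a₀ ∈ V₀ → a₁ ∈ V₀ → a₂ ∈ V₀ → a₃ ∈ V₀ →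
      (8 : ℤ) ∣ ∑ ε : Fin 4 → Bool, e (fun j => x j ^^ decide (Odd #(univ.filter fun i =>
        ε i && (![a₀, a₁, a₂, a₃] : Fin 4 → Fin ((3 * (k + 4) + 1) + (3 * (k + 4) + 1)) → Bool) i j))) := by
    intro x hx a₀ a₁ a₂ a₃ ha₀ ha₁ ha₂ ha₃
    have hdv := fs_flat_sum_dvd (e := 6) g u hg hu x ![t₁, t₂, t₃, t₄, t₅, a₀, a₁, a₂, a₃] (by omega)
    obtain ⟨zf, hzf⟩ := sl_sum_sZ_flat f hf x ![t₁, t₂, t₃, t₄, t₅, a₀, a₁, a₂, a₃]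
    have hzf' : ∑ ε : Fin 9 → Bool, 2 ^ (k + 4) * sZ (f (fun j => x j ^^ decide (Odd #(univ.filter fun i =>
          ε i && (![t₁, t₂, t₃, t₄, t₅, a₀, a₁, a₂, a₃] : Fin 9 → Fin ((3 * (k + 4) + 1) + (3 * (k + 4) + 1)) → Bool) i j)))) =
        2 ^ 6 * (2 ^ (k + 1) * zf) := by
      rw [← mul_sum, hzf]; norm_num; ring
    have h64' : (2 : ℤ) ^ 6 ∣ ∑ ε : Fin 9 → Bool, F (fun j => x j ^^ decide (Odd #(univ.filter fun i =>
          ε i && (![t₁, t₂, t₃, t₄, t₅, a₀, a₁, a₂, a₃] : Fin 9 → Fin ((3 * (k + 4) + 1) + (3 * (k + 4) + 1)) → Bool) i j))) := by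
      simp only [F]
      rw [sum_sub_distrib, hzf']
      exact dvd_sub hdv (Dvd.intro _ rfl)
    rw [hloc x hx ![a₀, a₁, a₂, a₃] (fun i => by fin_cases i <;> assumption), ← mul_sum,
      show (2 : ℤ) ^ 6 = 8 * 8 by norm_num] at h64'
    exact (mul_dvd_mul_iff_left (by norm_num : (8 : ℤ) ≠ 0)).1 h64'
  -- the engine and the pairing
  have hE := fl1_flat_l1 V₀ P x₁ h0 hadd hS e he H3 H4
  set A : (Fin ((3 * (k + 4) + 1) + (3 * (k + 4) + 1)) → Bool) → ℝ := fun x => if x ∈ P then (e x : ℝ) else 0 with hA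
  have hAτ : (fun x => (u x : ℝ) - (2 : ℝ) ^ (k + 4) * signOf (f x)) = fun x => 8 * A x := by
    funext x
    have h2 : (u x : ℝ) - (2 : ℝ) ^ (k + 4) * signOf (f x) = (((u x - 2 ^ (k + 4) * sZ (f x) : ℤ)) : ℝ) := by
      push_cast; rw [tp_sZ_cast]
    rw [h2]
    by_cases hx : x ∈ P
    · simp only [A, if_pos hx]
      have := hFe x; simp only [F] at this; rw [this]; push_cast; ring
    · simp only [A, if_neg hx]
      have := hF0 x hx; simp only [F] at this; rw [this]; norm_num
  have hpair := tms_pairing (k + 4) f g u hu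
  rw [hAτ] at hpair
  have hpair' : ∑ y, signOf (g y) * W A y = (2 : ℝ) ^ (8 * k + 32) := by
    have e2 : ∀ y, signOf (g y) * W (fun x => 8 * A x) y = 8 * (signOf (g y) * W A y) := fun y => by
      rw [fl1_W_smul]; ring
    rw [sum_congr rfl fun y _ => e2 y, ← mul_sum,
      show (2 : ℝ) ^ (10 * (k + 4) + 3) = 2 ^ (2 * k + 8) * 2 ^ (8 * (k + 4) + 3) by ring, mul_assoc, hTeq] at hpair
    have e3 : (2 : ℝ) ^ (2 * k + 8) * 2 ^ (6 * k + 27) = 8 * 2 ^ (8 * k + 32) := by ring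
    rw [e3] at hpair
    linarith
  have hge : (2 : ℝ) ^ (8 * k + 32) ≤ ∑ y, |W A y| := by rw [← hpair']; exact fl1_pairing_le_l1 g (W A)
  have hsq : ((2 : ℝ) ^ (8 * k + 32)) ^ 2 ≤ (∑ y, |W A y|) ^ 2 := pow_le_pow_left₀ (by positivity) hge 2
  have hEn : (∑ y, |W A y|) ^ 2 ≤ (2 : ℝ) ^ (12 * k + 54) := by
    refine hE.trans (le_of_eq ?_)
    rw [show ((3 * (k + 4) + 1) + (3 * (k + 4) + 1)) = 6 * k + 26 by ring]
    ring
  have hbig : (2 : ℝ) ^ (12 * k + 54) < ((2 : ℝ) ^ (8 * k + 32)) ^ 2 := by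
    have e2 : ((2 : ℝ) ^ (8 * k + 32)) ^ 2 = 2 ^ (12 * k + 54) * 2 ^ (4 * k + 10) := by ring
    rw [e2]
    have h1 : (1 : ℝ) < 2 ^ (4 * k + 10) := one_lt_pow₀ (by norm_num) (by omega)
    have h2 : (0 : ℝ) < 2 ^ (12 * k + 54) := by positivity
    exact lt_mul_of_one_lt_right h2 h1
  linarith

end Summit.QuantumAdvantage.QuantumAdvantage.Theorems.CubicForrelation.NearExactIsExact

end
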